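import Mathlib.Analysis.Calculus.Deriv.Basic
import Mathlib.Topology.Order.DenselyOrdered
import HarnessLib

/-!
# Extending by zero a differentiable function that vanishes near the ends of an interval

A bookkeeping lemma used to pass from the radial ODE on a bounded radial interval (where Carter's
separation produces `C²` mode coefficients) to globally defined `C²` functions of `r` (and then of
`r*`), for solutions cut off to a compact radial shell: if `f` is differentiable on `(α, β)` with
derivative `f'` and vanishes on the end-collars `(α, α')` and `(β', β)`, then the extension of `f`
by zero is differentiable on all of `ℝ`, with derivative the extension of `f'` by zero
(`hasDerivAt_zeroExtend`), and `f'` itself vanishes on the collars (`deriv_eq_zero_of_collar`), so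
the construction iterates to second derivatives (`hasDerivAt_zeroExtend_deriv`).
-/

noncomputable section

open Set Filter
open scoped Topology

namespace Literature.Analysis.Calculus

variable {F : Type*} [NormedAddCommGroup F]

/-- **Extension by zero** off the open interval `(α, β)`. [folklore] -/
def zeroExtend (α β : ℝ) (f : ℝ → F) (r : ℝ) : F := by
  classical
  exact if r ∈ Ioo α β then f r else 0

/-- On the interval the extension is `f`. [folklore] -/
theorem zeroExtend_of_mem {α β : ℝ} {f : ℝ → F} {r : ℝ} (hr : r ∈ Ioo α β) :
    zeroExtend α β f r = f r := by
  classical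
  exact if_pos hr

/-- Off the interval the extension is `0`. [folklore] -/
theorem zeroExtend_of_not_mem {α β : ℝ} {f : ℝ → F} {r : ℝ} (hr : r ∉ Ioo α β) :
    zeroExtend α β f r = 0 := by
  classical
  exact if_neg hr

section Collar

variable [NormedSpace ℝ F] {α α' β' β : ℝ} {f f' : ℝ → F}

omit [NormedSpace ℝ F] in
/-- A function vanishing on the end-collars `(α, α') ∪ (β', β)` of `(α, β)`: its zero extension
vanishes on a neighbourhood of every point outside `[α', β']`. [folklore] -/
theorem zeroExtend_eventuallyEq_zero
    (hz : ∀ r ∈ Ioo α β, r ∉ Icc α' β' → f r = 0) {r : ℝ} (hr : r ∉ Icc α' β') :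
    zeroExtend α β f =ᶠ[𝓝 r] fun _ ↦ 0 := by
  have hopen : IsOpen (Icc α' β')ᶜ := isClosed_Icc.isOpen_compl
  filter_upwards [hopen.mem_nhds hr] with s hs
  by_cases hsI : s ∈ Ioo α β
  · rw [zeroExtend_of_mem hsI]; exact hz s hsI hs
  · exact zeroExtend_of_not_mem hsI

/-- **The zero extension is differentiable everywhere**, with derivative the zero extension of
`f'`. [folklore] -/
theorem hasDerivAt_zeroExtend (hα : α < α') (hβ : β' < β)
    (hf : ∀ r ∈ Ioo α β, HasDerivAt f (f' r) r)
    (hz : ∀ r ∈ Ioo α β, r ∉ Icc α' β' → f r = 0) (r : ℝ) :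
    HasDerivAt (zeroExtend α β f) (zeroExtend α β f' r) r := by
  by_cases hrI : r ∈ Ioo α β
  · -- inside the interval the extension agrees with `f` near `r`
    rw [zeroExtend_of_mem hrI]
    refine (hf r hrI).congr_of_eventuallyEq ?_
    filter_upwards [isOpen_Ioo.mem_nhds hrI] with s hs
    exact zeroExtend_of_mem hs
  · -- outside: `r ∉ [α', β']`, so the extension vanishes near `r`
    rw [zeroExtend_of_not_mem hrI]
    have hr : r ∉ Icc α' β' := fun h ↦ hrI ⟨hα.trans_le h.1, h.2.trans_lt hβ⟩
    exact (hasDerivAt_const r (0 : F)).congr_of_eventuallyEq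
      (zeroExtend_eventuallyEq_zero hz hr)

/-- On the collars the derivative vanishes too. [folklore] -/
theorem deriv_eq_zero_of_collar (hα : α < α') (hβ : β' < β)
    (hf : ∀ r ∈ Ioo α β, HasDerivAt f (f' r) r)
    (hz : ∀ r ∈ Ioo α β, r ∉ Icc α' β' → f r = 0) {r : ℝ} (hrI : r ∈ Ioo α β)
    (hr : r ∉ Icc α' β') : f' r = 0 := by
  have h1 : HasDerivAt (zeroExtend α β f) (f' r) r := by
    have h := hasDerivAt_zeroExtend hα hβ hf hz r
    rwa [zeroExtend_of_mem hrI] at h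
  have h2 : HasDerivAt (zeroExtend α β f) 0 r :=
    (hasDerivAt_const r (0 : F)).congr_of_eventuallyEq (zeroExtend_eventuallyEq_zero hz hr)
  exact h1.unique h2

/-- **Second derivatives**: if moreover `f'` has derivative `f''` on `(α, β)`, the zero extension of
`f'` has derivative the zero extension of `f''` everywhere. [folklore] -/
theorem hasDerivAt_zeroExtend_deriv {f'' : ℝ → F} (hα : α < α') (hβ : β' < β)
    (hf : ∀ r ∈ Ioo α β, HasDerivAt f (f' r) r) (hf' : ∀ r ∈ Ioo α β, HasDerivAt f' (f'' r) r)
    (hz : ∀ r ∈ Ioo α β, r ∉ Icc α' β' → f r = 0) (r : ℝ) :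
    HasDerivAt (zeroExtend α β f') (zeroExtend α β f'' r) r :=
  hasDerivAt_zeroExtend hα hβ hf' (fun _ hs hs' ↦ deriv_eq_zero_of_collar hα hβ hf hz hs hs') r

omit [NormedSpace ℝ F] in
/-- The zero extension of a function continuous on `(α, β)` and vanishing on the collars is
continuous. [folklore] -/
theorem continuous_zeroExtend (hα : α < α') (hβ : β' < β) (hf : ContinuousOn f (Ioo α β))
    (hz : ∀ r ∈ Ioo α β, r ∉ Icc α' β' → f r = 0) : Continuous (zeroExtend α β f) := by
  refine continuous_iff_continuousAt.2 fun r ↦ ?_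
  by_cases hrI : r ∈ Ioo α β
  · have h : zeroExtend α β f =ᶠ[𝓝 r] f := by
      filter_upwards [isOpen_Ioo.mem_nhds hrI] with s hs
      exact zeroExtend_of_mem hs
    exact ((hf r hrI).continuousAt (isOpen_Ioo.mem_nhds hrI)).congr_of_eventuallyEq h
  · have hr : r ∉ Icc α' β' := fun h ↦ hrI ⟨hα.trans_le h.1, h.2.trans_lt hβ⟩
    exact (continuousAt_const (y := (0 : F))).congr_of_eventuallyEq
      (zeroExtend_eventuallyEq_zero hz hr)

omit [NormedSpace ℝ F] in
/-- The zero extension has support in `[α', β']`. [folklore] -/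
theorem zeroExtend_eq_zero_of_not_mem
    (hz : ∀ r ∈ Ioo α β, r ∉ Icc α' β' → f r = 0) {r : ℝ} (hr : r ∉ Icc α' β') :
    zeroExtend α β f r = 0 :=
  (zeroExtend_eventuallyEq_zero hz hr).self_of_nhds

end Collar

end Literature.Analysis.Calculus
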